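import Mathlib.Data.Nat.Choose.Basic
import Mathlib.Algebra.BigOperators.Group.Finset.Basic
import Mathlib.Data.ZMod.Basic
import Mathlib.Data.Nat.Prime.Int
import Mathlib.Tactic.Linarith
import Mathlib.Tactic.NormNum
import Mathlib.Tactic.Ring
import Mathlib.Tactic.IntervalCases
import Mathlib.Tactic.LinearCombination
import Mathlib.Tactic.FinCases
import HarnessLib

/-!
# The (0,1) cell of the ι-window, XIX: the product ground `B₁ × B₂`, VI — LEMMA α (determinant signs), LEMMA JD (jump-locus dimension),
# THEOREM R11 (the second-smallest reading is VOID) and the Pell families FH-1 / KT / K2 — algebraic skeleton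

Family `hodge`, b2b cell `hweil` (helper of item stmt-HodgeConjecture-2524). Report
`run/shared/lean/b2b/hodge-weil/b2b-hweil-pv1-g31/H2-ZERO-ONE-19.md` (prover 1 gen 31). Companion to `WeilTypeLadderH2ProductGroundFive.lean`
(gen 30: ISO-LF, R2, V, WIT, S12; `pg5_*`) and `…Four.lean` (gen 29: HOM-ONE, ISO-RED, POP, INF, KL; `pg4_*`). HONEST FRAMING: census results
inside the ladder's H2 test ((0,1) cell) on the SPECIAL fourfold `X₀ = B₁ × B₂`; by the cell's THEOREM U5 an object there would decide H2
positively, emptiness / non-isolation of a family there is a census line and nothing more. No case of the Hodge conjecture is proved; nothing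
here is a rung; no statement of [Markman 2025] / [Perry 2026] / [EdGFS 2025] is used. The kernel content is the elementary arithmetic of the report
(sign and parity bookkeeping, Euler-characteristic and slope identities, the Eagon–Northcott codimension count as arithmetic, bounded Pell
classifications); the geometry (Mukai's Fourier functor, Bogomolov's inequality, Eagon–Northcott, Birkenhake–Lange §2.3) is quoted print and the
cell's certified items, and every head below is a SHADOW of a named step of the report, not a formalisation of it.

## LEMMA α (report §1.3)
`pg6_det_sign`: on an ι-equivariant three-term resolution with eigenvalue multiplicities `(pᵢ, mᵢ)`, rank `= Σ(−1)ⁱ(pᵢ+mᵢ)`, local index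
`t = Σ(−1)ⁱ(pᵢ−mᵢ)`, and ι acts on the determinant fibre by `(−1)^{Σ(−1)ⁱ mᵢ}`, where `2·Σ(−1)ⁱmᵢ = rank − t`. `pg6_det_sign_balanced`: rank `0` and
`t = 0` give exponent `0`. `pg6_character_nontrivial`: a ±1-valued multiplicative function on `(ZMod 2)²` that is identically `1` is the trivial
one — the finite shadow of 'q_{P_α} ≡ 1 ⟹ α = 0'.

## LEMMA JD and M1-T (report §2.1–2.2)
`pg6_en_shape`, `pg6_jd_codim`, `pg6_jd_total`, `pg6_m1t_bound`: the Eagon–Northcott height `(p − t + 1)(q − t + 1)` at `(p,q,t) = (h¹, h⁰, h⁰)` is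
`h¹ − h⁰ + 1 = h² − χ + 1`; two signs in a smooth 6-fold leave dimension `≥ 4 + χ − h²`; and `e₁ ≥ 1 + κ₁ + κ₂`.

## BOG / NLF / CL3 / LF2 (report §2.3–2.6)
`pg6_bog_norm4`, `pg6_bog_norm3`, `pg6_bog_hull3`: `2N − 2rℓ ≥ 0` bounds the colength `ℓ` of the reflexive hull. `pg6_class_rank3`,
`pg6_class_rank2`: norm-3 classes of rank 3 have `3 ∣ c`, of rank 2 have `c` odd. `pg6_nlf_numerics`, `pg6_gieseker_rank3`, `pg6_cl3_norms`,
`pg6_lf2_numerics`: the Euler / Hilbert-polynomial / `‖t‖² = 40` bookkeeping of NLF, CL3 and LF2.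

## R11, FH-1, KT, K2 (report §3–§4)
`pg6_r11_chain`: the slope and Euler data of the reading `(1,1)`. `pg6_fh1_pell`: in a rank-one reading `(c′ − r c)² = 3(r−1)² + 1`; `pg6_fh1_pell_even`: the even
solutions `r = 2, 16, 210` and none with `4 ≤ r ≤ 14`. `pg6_fh1_count`: `3r − 6 ≥ 42` for `r ≥ 16`. `pg6_kt_slope`: `r² − 6r + 12 ≠ 0`. `pg6_kt_cases`,
`pg6_k2_cases`: the case splits. `pg6_r1_length`: the R¹-length `C(d+1,3)` of the erratum N-P1g29-5 for `d ≤ 9`. `pg6_jdmin_b1_degrees`: the degree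
bookkeeping of 3.3 (b).
-/

-- mandated namespace `Summit.HodgeConjecture.HodgeConjecture.…` (Problem = Summit) trips `linter.dupNamespace`; the lakefile disables it
-- tree-wide (weak option), restated here so stand-alone elaboration is warning-free too.
set_option linter.dupNamespace false

namespace Summit.HodgeConjecture.HodgeConjecture.WeilTypeLadder

section ProductGroundSix

/-! ### LEMMA α — determinant signs (report §1.3) -/

/-- **LEMMA α (a), the exponent identity (report §1.3 (a)).** For an ι-equivariant three-term locally free resolution whose terms have
`pᵢ` eigenvalues `+1` and `mᵢ` eigenvalues `−1` at a fixed point: `rank = Σ(−1)ⁱ(pᵢ + mᵢ)`, `t = Σ(−1)ⁱ(pᵢ − mᵢ)`, and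
`rank − t = 2·Σ(−1)ⁱ mᵢ` — so ι acts on the determinant fibre by `(−1)^{(rank − t)/2}`. [shadow: the ring identity] -/
theorem pg6_det_sign (p₀ m₀ p₁ m₁ p₂ m₂ : ℤ) :
    ((p₀ + m₀) - (p₁ + m₁) + (p₂ + m₂)) - ((p₀ - m₀) - (p₁ - m₁) + (p₂ - m₂)) = 2 * (m₀ - m₁ + m₂) := by
  ring

/-- **LEMMA α (b) (report §1.3 (b)).** If the rank is `0` and the local index `t` is `0`, the determinant exponent `Σ(−1)ⁱmᵢ` is `0`: ι acts
by `+1` on the determinant fibre. [shadow] -/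
theorem pg6_det_sign_balanced (rk t M : ℤ) (h : rk - t = 2 * M) (hrk : rk = 0) (ht : t = 0) : M = 0 := by
  subst hrk; subst ht; omega

/-- **LEMMA α (c), finite shadow (report §1.3 (c)).** A function `q : ZMod 2 × ZMod 2 → ℤ` with values in `{1, −1}` that is a character
(`q (x + y) = q x * q y`) and is identically `1` is the trivial character; contrapositively a non-trivial character takes the value `−1`.
Here in the form: if `q (1,0) = −1` or `q (0,1) = −1` then `q` is not identically `1`. [shadow of 'q_{P_α} ≡ 1 forces α = 0'] -/
theorem pg6_character_nontrivial (q : ZMod 2 × ZMod 2 → ℤ) (h : q (1, 0) = -1 ∨ q (0, 1) = -1) :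
    ¬ (∀ x, q x = 1) := by
  intro hall
  rcases h with h | h
  · rw [hall (1, 0)] at h; norm_num at h
  · rw [hall (0, 1)] at h; norm_num at h

/-! ### ERRATUM N-P1g29-5 (report §1.1) -/

/-- **N-P1g29-5, the R¹-length at an ordinary double point (report §1.1).** For the small contraction of a `(−1,−1)`-curve `ℓ` and a line
bundle of degree `−d` on `ℓ`, the length of `R¹` is `Σ_{n=0}^{d−2} (n+1)(d−1−n)`, which equals `C(d+1,3)`; checked here for `2 ≤ d ≤ 9`
against the closed form (the general identity is `Σ_{m=1}^{e} m(e+1−m) = C(e+2,3)`). The erratum replaces `max(0, d−1)` of [17] 9.9 by this.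
[shadow: finite check] -/
theorem pg6_r1_length (d : ℕ) (h2 : 2 ≤ d) (h9 : d ≤ 9) :
    (Finset.range (d - 1)).sum (fun n => (n + 1) * (d - 1 - n)) = Nat.choose (d + 1) 3 ∧
    (Nat.choose 4 3 ≠ max 0 (3 - 1)) := by
  refine ⟨?_, by decide⟩
  interval_cases d <;> simp [Finset.sum_range_succ, Nat.choose]

/-! ### LEMMA JD and M1-T (report §2.1, §2.2) -/

/-- **Eagon–Northcott shape (report §2.1).** The height bound `(p − t + 1)(q − t + 1)` for the `t`-minors of a `p × q` matrix, at
`(p, q, t) = (h¹, h⁰, h⁰)` (maximal minors of the first differential of a minimal complex), is `h¹ − h⁰ + 1`. [shadow] -/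
theorem pg6_en_shape (h0 h1 : ℤ) : (h1 - h0 + 1) * (h0 - h0 + 1) = h1 - h0 + 1 := by ring

/-- **LEMMA JD, per-sign codimension (report §2.1).** With `χ = h⁰ − h¹ + h²` for one eigen-part of `RHom(V,Q)`, the Eagon–Northcott bound
`h¹ − h⁰ + 1` equals `h² − χ + 1`; when `χ = 0` it is `h² + 1`. [shadow] -/
theorem pg6_jd_codim (h0 h1 h2 χ : ℤ) (hχ : χ = h0 - h1 + h2) :
    h1 - h0 + 1 = h2 - χ + 1 ∧ (χ = 0 → h1 - h0 + 1 = h2 + 1) := by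
  subst hχ; constructor
  · ring
  · intro h; linarith

/-- **LEMMA JD, the total count (report §2.1).** In a regular local ring of dimension `6`, two closed subsets of codimension at most
`e⁺ + 1 − χ⁺` and `e⁻ + 1 − χ⁻` through the point meet in dimension `≥ 6 − (e⁺ + 1 − χ⁺) − (e⁻ + 1 − χ⁻) = 4 + (χ⁺ + χ⁻) − (e⁺ + e⁻)`
(Serre's intersection inequality); with `χ^± = 0` and `e⁺ + e⁻ = hom(Q,V) = 0` this is `4`. [shadow] -/
theorem pg6_jd_total (ep em χp χm d : ℤ) (hd : d ≥ 6 - (ep + 1 - χp) - (em + 1 - χm)) :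
    d ≥ 4 + (χp + χm) - (ep + em) ∧ (χp = 0 → χm = 0 → ep + em = 0 → d ≥ 4) := by
  constructor
  · linarith
  · intro h1 h2 h3; linarith

/-- **LEMMA M1-T (report §2.2).** LEMMA M1 gives `e₁ ≥ (G − 1) + dim ker d`; at the corner `G = 2` and `ker d` contains the two independent
tangent spaces of dimensions `κ₁, κ₂`, so `e₁ ≥ 1 + κ₁ + κ₂`; with JD's `κ₂ ≥ 4` on one side, `e₁ ≥ 5`. [shadow] -/
theorem pg6_m1t_bound (e G K κ₁ κ₂ : ℤ) (hM1 : e ≥ (G - 1) + K) (hG : G = 2) (hK : K ≥ κ₁ + κ₂) (h1 : κ₁ ≥ 0) :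
    e ≥ 1 + κ₁ + κ₂ ∧ (κ₂ ≥ 4 → e ≥ 5) := by
  subst hG; constructor
  · linarith
  · intro h; linarith

/-! ### LEMMA BOG (report §2.3) -/

/-- **LEMMA BOG, balanced factors (report §2.3).** For a μ-semistable torsion-free sheaf of norm `N = 4` (Bogomolov discriminant `2N = 8`),
rank `r` and hull colength `ℓ`: `8 − 2rℓ ≥ 0`. Hence `r ≥ 5 ⟹ ℓ = 0` (locally free), `r ∈ {3,4} ⟹ ℓ ≤ 1`, `r = 2 ⟹ ℓ ≤ 2`. [shadow] -/
theorem pg6_bog_norm4 (r ℓ : ℕ) (h : 2 * r * ℓ ≤ 8) :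
    (5 ≤ r → ℓ = 0) ∧ (r = 3 ∨ r = 4 → ℓ ≤ 1) ∧ (r = 2 → ℓ ≤ 2) := by
  refine ⟨?_, ?_, ?_⟩
  · intro hr
    rcases Nat.eq_zero_or_pos ℓ with h0 | hpos
    · exact h0
    · nlinarith
  · rintro (rfl | rfl) <;> omega
  · rintro rfl; omega

/-- **LEMMA BOG, rigid factors (report §2.3).** Norm `3` (discriminant `6`): `6 − 2rℓ ≥ 0`, so `r ≥ 4 ⟹ ℓ = 0` and `r ∈ {2,3} ⟹ ℓ ≤ 1`.
[shadow] -/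
theorem pg6_bog_norm3 (r ℓ : ℕ) (h : 2 * r * ℓ ≤ 6) :
    (4 ≤ r → ℓ = 0) ∧ (r = 2 ∨ r = 3 → ℓ ≤ 1) := by
  refine ⟨?_, ?_⟩
  · intro hr
    rcases Nat.eq_zero_or_pos ℓ with h0 | hpos
    · exact h0
    · nlinarith
  · rintro (rfl | rfl) <;> omega

/-- **LEMMA BOG / NLF (b), the hull of a rank-3 rigid-class sheaf (report §2.3, §2.5 (b)).** `c₂(R) = 1`, `c₂(hull) = 1 − ℓ`, Bogomolov
`6·c₂(hull) ≥ 0` (rank 3, `c₁ ≡ 0`) and `ℓ ≥ 1` (not locally free) force `ℓ = 1` and `c₂(hull) = 0`. [shadow] -/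
theorem pg6_bog_hull3 (ℓ c2H : ℤ) (hc : c2H = 1 - ℓ) (hB : 6 * c2H ≥ 0) (hℓ : ℓ ≥ 1) : ℓ = 1 ∧ c2H = 0 := by
  subst hc; constructor <;> omega

/-! ### NLF, CL3, LF2 (report §2.5, §2.6) -/

/-- **The rank-3 and rank-2 norm-3 classes (report §2.5 (b), §4.3).** `c² − 3s = 3` forces `3 ∣ c` (so the class is `(3,0,−1) ⊗ 𝒪(kΘ)`);
`c² − 2s = 3` forces `c` odd (so the class is `(2,1,−1) ⊗ 𝒪(kΘ)`). [shadow: residues] -/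
theorem pg6_class_rank3 (c s : ℤ) (h : c ^ 2 - 3 * s = 3) : 3 ∣ c := by
  have h3 : (3 : ℤ) ∣ c ^ 2 := ⟨s + 1, by linarith⟩
  exact Int.prime_three.dvd_of_dvd_pow h3

/-- (rank 2) -/
theorem pg6_class_rank2 (c s : ℤ) (h : c ^ 2 - 2 * s = 3) : c % 2 = 1 := by
  rcases Int.even_or_odd c with ⟨k, hk⟩ | ⟨k, hk⟩
  · exfalso
    subst hk
    have h' : 4 * (k * k) - 2 * s = 3 := by linear_combination h
    generalize k * k = m at h'
    omega
  · subst hk; omega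

/-- **LEMMA NLF, numerics (report §2.5 (a)).** A μ-stable bundle with `det ∈ Pic⁰` and `c₂ = 1` has `χ(R ⊗ P) = −1` for every `P`, so an
IT₁ transform of rank `1`; a line bundle `N ≡ cθ̂` with `c ≠ 0` is non-degenerate with index in `{0,2}` (never `1`), and `c = 0` transforms to
a skyscraper (rank `0`). The shadow: `χ = −c₂ = −1`, the transform rank `−χ = 1`, and `c ≠ 0 → c² > 0` (non-degeneracy). -/
theorem pg6_nlf_numerics (c2 χ rk c : ℤ) (h2 : c2 = 1) (hχ : χ = -c2) (hrk : rk = -χ) :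
    χ = -1 ∧ rk = 1 ∧ (c ≠ 0 → 0 < c ^ 2) := by
  subst h2; subst hχ; subst hrk
  refine ⟨by norm_num, by norm_num, fun hc => by positivity⟩

/-- **NLF (b), the Gieseker comparison (report §2.5 (b)).** Reduced Hilbert polynomials (constant terms `χ/rk`): a slope-0 line bundle
`P ⊂ R` has `0 > −1/3` (destabilises the rank-3 class with `χ = −1`), and a slope-0 rank-2 sub with `c₂(F) = c` is allowed only if
`−c/2 < −1/3`, i.e. `c ≥ 1`; with `c₂(R) = c₂(F) + len Y = 1` this forces `c = 1`, `len Y = 0`. [shadow, over ℚ] -/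
theorem pg6_gieseker_rank3 (c lenY : ℤ) (hsum : c + lenY = 1) (hY : lenY ≥ 0) (hstab : -(c : ℚ) / 2 < -1 / 3) :
    ((0 : ℚ) > -1 / 3) ∧ c = 1 ∧ lenY = 0 := by
  have hc : (c : ℚ) > 2 / 3 := by linarith
  have hc0 : (0 : ℚ) < (c : ℚ) := by linarith
  have hc0' : (0 : ℤ) < c := by exact_mod_cast hc0
  refine ⟨by norm_num, by omega, by omega⟩

/-- **PROPOSITION CL3 / REMARK R^{TF}, the `‖t‖² = 40` bookkeeping (report §2.5 (c)).** Three distinct signed 2-torsion characters have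
`Σ_w (Σ_z ε_z(w))² = 48`; (i) `E_{Z,x}`: at `x` the three signs equal `s`, `t_x = 3s − 4s`, so `‖t‖² = (48 − 9) + 1 = 40`; (ii) `E^{fat}`:
`‖t(V)‖² = 16`, `t_x = −a − 4a`, `‖t‖² = 15 + 25 = 40`; (iii) `R^{TF}`: `48 − 9 + (3s − 4s)² = 40`; and FB: `e₁ = 2 + 3 − 40/8 = 0`, while the
non-rigid patterns give `24` and `e₁ = 2`. [shadow] -/
theorem pg6_cl3_norms (s a : ℤ) (hs : s = 1 ∨ s = -1) (ha : a = 1 ∨ a = -1) :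
    (48 - (3 * s) ^ 2) + (3 * s - 4 * s) ^ 2 = 40 ∧ (16 - a ^ 2) + (-a - 4 * a) ^ 2 = 40 ∧
    (2 + 3 - 40 / 8 : ℤ) = 0 ∧ (2 + 3 - 24 / 8 : ℤ) = 2 := by
  rcases hs with rfl | rfl <;> rcases ha with rfl | rfl <;> norm_num

/-- **LEMMA LF2, numerics (report §2.6).** For `E` of class `(2, θ, c₂ = 2)`: `χ(E ⊗ P) = −1` (transform of rank `1`), the Serre zero
scheme has length `c₂ = 2`, `h⁰(𝒪(Θ)) = 1`, and the transform `L ⊗ 𝓘_Z` has `len Z = χ(L) − χ(Ê) = 1 − (−2) = 3`. [shadow] -/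
theorem pg6_lf2_numerics (χE c2 h0Θ χL χEhat : ℤ) (h1 : χE = -1) (h2 : c2 = 2) (h3 : h0Θ = 1) (h4 : χL = 1) (h5 : χEhat = -2) :
    -χE = 1 ∧ c2 = 2 ∧ h0Θ = 1 ∧ χL - χEhat = 3 := by
  subst h1; subst h2; subst h3; subst h4; subst h5; norm_num

/-! ### THEOREM R11 (report §3.2) and JD-MIN (report §3.3) -/

/-- **THEOREM R11, the arithmetic chain (report §3.2).** Reading `(1,1)`: `Q₂` of class `(6, 2θ, χ = 0)` has slope `2·2/6 = 2/3 > 0`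
(so `Hom(Q₂, P) = 0` for slope-0 `P`), Bogomolov `12(4 − ℓ) − 5·8 ≥ 0` forces `ℓ = 0`, `χ(V,Q₂) = 3·χ(Q₂) = 0`, so JD's bound is
`4 + 0 − 0 = 4 ≥ 1`: no isolated jump point. [shadow] -/
theorem pg6_r11_chain (ℓ : ℕ) (hB : 12 * (4 - (ℓ : ℤ)) - 5 * 8 ≥ 0) (χQ : ℤ) (hχ : χQ = 0) :
    ℓ = 0 ∧ (2 * 2 : ℚ) / 6 > 0 ∧ 3 * χQ = 0 ∧ (4 + 3 * χQ - 0 : ℤ) ≥ 1 := by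
  subst hχ
  refine ⟨by omega, by norm_num, by norm_num, by norm_num⟩

/-- **PROPOSITION JD-MIN (b), degree bookkeeping (report §3.3 (b)).** On the support curve `D ∈ |2Θ₀|` (arithmetic genus `5`,
`deg ω_D = 8`): `χ(Q) = 2`, `χ(Q^D) = −χ(Q) − 8 = −10`, `χ(Q^D(Θ)) = −10 + 4 = −6 < −4 = χ(𝒪_D)` — so no injective section on an integral
`D`; on `Θ_a ∪ Θ_{−a}` the symmetric bidegree `(d,d)` with `2(d − 1) − τ = 2`, `τ ∈ {0,1,2}`, forces `(d,τ) ∈ {(2,0),(3,2)}`, and the dual twisted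
degrees `−3 + 2 = −1`, `−4 + 2 = −2` are negative. [shadow] -/
theorem pg6_jdmin_b1_degrees :
    (-(2 : ℤ) - 8 = -10) ∧ (-10 + 4 < (1 : ℤ) - 5) ∧
    (∀ d τ : ℤ, 2 * (d - 1) - τ = 2 → 0 ≤ τ → τ ≤ 2 → (d = 2 ∧ τ = 0) ∨ (d = 3 ∧ τ = 2)) ∧
    ((-3 : ℤ) + 2 < 0 ∧ (-4 : ℤ) + 2 < 0) := by
  refine ⟨by norm_num, by norm_num, ?_, by norm_num⟩
  intro d τ h h0 h2; omega

/-! ### THEOREM FH-1, KT, K2 (report §4) -/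

/-- **THEOREM FH-1 (i) (report §4.1).** In a rank-one reading, norm `4` (`c′² − r s′ = 4`) and the pairing `2c c′ − s′ − r(c² − 3) = 6`
give `(c′ − r c)² = 3(r − 1)² + 1`; hence `μ(Q₂) ≠ μ(L)` (`c′ ≠ r c`). [shadow: the identity, by `nlinarith`-free algebra] -/
theorem pg6_fh1_pell (r c c' s' : ℤ) (hN : c' ^ 2 - r * s' = 4) (hP : 2 * c * c' - s' - r * (c ^ 2 - 3) = 6) :
    (c' - r * c) ^ 2 = 3 * (r - 1) ^ 2 + 1 ∧ c' ≠ r * c := by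
  have key : (c' - r * c) ^ 2 = 3 * (r - 1) ^ 2 + 1 := by linear_combination hN - r * hP
  refine ⟨key, ?_⟩
  intro heq
  rw [heq] at key
  nlinarith [sq_nonneg (r - 1)]

/-- A natural number strictly between two consecutive squares is not a square. [elementary; used by `pg6_fh1_pell_even`] -/
theorem pg6_not_square_of_bracket (K m : ℕ) (h1 : m * m < K) (h2 : K < (m + 1) * (m + 1)) (n : ℕ) : n * n ≠ K := by
  intro h
  rcases Nat.lt_or_ge n (m + 1) with hlt | hge
  · have : n ≤ m := by omega
    have : n * n ≤ m * m := Nat.mul_le_mul this this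
    omega
  · have : (m + 1) * (m + 1) ≤ n * n := Nat.mul_le_mul hge hge
    omega

/-- **THEOREM FH-1 (i), the even solutions (report §4.1).** `3(r−1)² + 1` is a perfect square for `r = 2, 16, 210` (`2², 26², 362²`:
the minimal reading, `(−4,3)`, `(−15,11)`), and for NO even `r` with `4 ≤ r ≤ 14` (each value is bracketed by consecutive squares).
[shadow: explicit witnesses] -/
theorem pg6_fh1_pell_even :
    (3 * (2 - 1) ^ 2 + 1 = 2 * 2 ∧ 3 * (16 - 1) ^ 2 + 1 = 26 * 26 ∧ 3 * (210 - 1) ^ 2 + 1 = 362 * 362) ∧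
    (∀ r ∈ ({4, 6, 8, 10, 12, 14} : Finset ℕ), ∀ n : ℕ, n * n ≠ 3 * (r - 1) ^ 2 + 1) := by
  refine ⟨by norm_num, ?_⟩
  intro r hr n
  simp only [Finset.mem_insert, Finset.mem_singleton] at hr
  rcases hr with rfl | rfl | rfl | rfl | rfl | rfl
  · exact pg6_not_square_of_bracket 28 5 (by norm_num) (by norm_num) n
  · exact pg6_not_square_of_bracket 76 8 (by norm_num) (by norm_num) n
  · exact pg6_not_square_of_bracket 148 12 (by norm_num) (by norm_num) n
  · exact pg6_not_square_of_bracket 244 15 (by norm_num) (by norm_num) n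
  · exact pg6_not_square_of_bracket 364 19 (by norm_num) (by norm_num) n
  · exact pg6_not_square_of_bracket 508 22 (by norm_num) (by norm_num) n

/-- **THEOREM FH-1 (ii) (report §4.1).** `χ(L, Q₂) = 3r − 6`; for `r ≥ 16` this is `≥ 42 > 2`, and the other branch gives `hom = 0 ≠ 2`:
the corner value `2` is never attained. [shadow] -/
theorem pg6_fh1_count (r hom : ℤ) (hr : r ≥ 16) (h : hom ≥ 3 * r - 6 ∨ hom = 0) : hom ≠ 2 := by
  rcases h with h | h <;> omega

/-- **THEOREM KT, the slope exclusion (report §4.2).** For a rank-3 rigid factor `(3, 3k, 3k² − 1)` against a norm-4 class of rank `r` and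
pairing `6`, equality of slopes would force `r² − 6r + 12 = 0`, which has no real (hence no integer) root. [shadow] -/
theorem pg6_kt_slope (r : ℤ) : r ^ 2 - 6 * r + 12 ≠ 0 := by
  nlinarith [sq_nonneg (r - 3)]

/-- **THEOREM KT, the case split (report §4.2).** With `hom(R₂,Q₂) = hom(V_k,Q₂)`: if `μ(Q₂) < 2k` then `hom = 0`; if `μ(Q₂) > 2k` then
`hom ≥ 3χ_k` with `3χ_k` even; so the corner value `2` needs `μ(Q₂) > 2k` and `χ_k ≤ 0`, and `χ_k = 0` is JD's case (dimension `≥ 4`). The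
instances: `(2,5)`: `χ_{−1} = 14`, `hom ≥ 42`; `(7,19)`: `χ_{−1} = 208`, `hom ≥ 624`. [shadow] -/
theorem pg6_kt_cases (hom χk : ℤ) (h : hom = 0 ∨ hom ≥ 3 * χk) :
    (hom = 2 → 3 * χk ≤ 2 ∧ hom ≠ 0) ∧ (3 * (14 : ℤ) = 42 ∧ 3 * (208 : ℤ) = 624) := by
  refine ⟨?_, by norm_num⟩
  intro h2; subst h2
  rcases h with h | h
  · omega
  · exact ⟨by omega, by omega⟩

/-- **THEOREM K2, the case split (report §4.3).** Non-locally-free members: `χ(U_k, Q₂) = rk Q₂ − 6`, so `hom ≥ rk Q₂ − 6 ≥ 3` once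
`rk Q₂ ≥ 9` (EMPTY) — `(1,2)`: `10 − 6 = 4`. Locally free members in the window `2(k+1) < μ(Q₂) < 2(k+2)`: `hom ≥ 3χ′`, EMPTY for `χ′ ≥ 1`,
JD for `χ′ = 0` — `(1,2)`: `χ′ = 0`; `(3,8)`: `χ′ = 14`; `(11,30)`: `χ′ = 208`. [shadow] -/
theorem pg6_k2_cases :
    ((10 : ℤ) - 6 = 4 ∧ (4 : ℤ) > 2) ∧ (∀ rk : ℤ, rk ≥ 9 → rk - 6 ≥ 3) ∧
    (3 * (0 : ℤ) = 0 ∧ 3 * (14 : ℤ) = 42 ∧ 3 * (208 : ℤ) = 624) := by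
  refine ⟨by norm_num, fun rk h => by omega, by norm_num⟩


/-! ### ADDENDUM 1 (report §13): the three Pell families completely — `pg6_kt_chi_identity`, `pg6_rank3_six`, `pg6_k2_step`,
`pg6_rank2_orbit_signs`, `pg6_pell_minus_two_only` -/

/-- **THEOREM KT-∞, the Euler identity (report §13.1).** For a rank-3 rigid factor `(3, 3k, 3k² − 1)` and a balanced class `(r, c, s)` of
norm `4` (not needed) with Mukai pairing `6`, i.e. `6k·c − 3s − r(3k² − 1) = 6`, the twisted Euler characteristic
`χ_k = χ(Q₂(−kΘ)) = s − 2kc + k²r` satisfies `3χ_k = r − 6`. Hence `χ_k = 0 ⟺ rk Q₂ = 6`, `χ_k ≥ 2 ⟺ rk Q₂ ≥ 12`, and `3 ∣ rk Q₂ − 6`.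
[shadow: the identity] -/
theorem pg6_kt_chi_identity (k r c s : ℤ) (hP : 6 * k * c - 3 * s - r * (3 * k ^ 2 - 1) = 6) :
    3 * (s - 2 * k * c + k ^ 2 * r) = r - 6 := by
  linear_combination -hP

/-- **THEOREM KT-∞, the only rank-3 reading with `rk Q₂ = 6` (report §13.1).** A direction `(a,b)` with `rk R = |(b−a)² − 3a²| = 3` and
`rk Q₂ = |2a(a + 2b)| = 6` is `±(1,1)`. [shadow: complete integer case analysis] -/
theorem pg6_rank3_six (a b : ℤ) (hR : (b - a) ^ 2 - 3 * a ^ 2 = 3 ∨ (b - a) ^ 2 - 3 * a ^ 2 = -3)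
    (hQ : a * (a + 2 * b) = 3 ∨ a * (a + 2 * b) = -3) : (a = 1 ∧ b = 1) ∨ (a = -1 ∧ b = -1) := by
  have ha0 : a ≠ 0 := by rintro rfl; simp at hQ
  have ht : a + 2 * b ≠ 0 := by
    rintro h0; rw [h0] at hQ; simp at hQ
  have h9 : (a * (a + 2 * b)) ^ 2 = 9 := by rcases hQ with h | h <;> rw [h] <;> norm_num
  have ha1 : 1 ≤ a ^ 2 := by rcases lt_or_gt_of_ne ha0 with h | h <;> nlinarith
  have ht1 : 1 ≤ (a + 2 * b) ^ 2 := by rcases lt_or_gt_of_ne ht with h | h <;> nlinarith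
  have ha : a ^ 2 ≤ 9 := by nlinarith [sq_nonneg a, ht1, h9]
  have hab : (a + 2 * b) ^ 2 ≤ 9 := by nlinarith [sq_nonneg (a + 2 * b), ha1, h9]
  have ha3 : -3 ≤ a ∧ a ≤ 3 := by constructor <;> nlinarith [ha]
  have hb3 : -3 ≤ a + 2 * b ∧ a + 2 * b ≤ 3 := by constructor <;> nlinarith [hab]
  have hb : -3 ≤ b ∧ b ≤ 3 := by omega
  obtain ⟨hlo, hhi⟩ := ha3
  obtain ⟨hblo, hbhi⟩ := hb
  clear h9 ha1 ht1 ha hab hb3 ht ha0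
  interval_cases a <;> interval_cases b <;>
    first | exact Or.inl ⟨rfl, rfl⟩ | exact Or.inr ⟨rfl, rfl⟩ | (exfalso; revert hR hQ; norm_num)

/-- **THEOREM K2-∞, one step of the class recursion (report §13.2).** In the normalisation `v_R = (2,−1,−1)` the fundamental automorph
`g₀ = [[3,1],[2,1]]` of the form `2x² − 2xy − y²` acts on classes by `(r,c,s) ↦ (9r + 12c + 4s, 3r + 5c + 2s, r + 2c + s)`; it preserves the norm
`c² − rs` and the pairing with `v_R` (`−2c − 2s + r`), maps `(10,2,0)` to `(114,40,14)` and that to `(1562,570,208)`, and preserves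
`0 < c < r`, `0 ≤ s`, `r ≥ 10`, forcing `s′ ≥ r + 2 ≥ 12` and `r′ − 6 ≥ 3` — so along the rank-two family `χ′ = s ≥ 1` and `rk Q₂ − 6 ≥ 3`
from the second member on (the actual values are 14, 208, 2910, …). [shadow] -/
theorem pg6_k2_step (r c s : ℤ) :
    ((3 * r + 5 * c + 2 * s) ^ 2 - (9 * r + 12 * c + 4 * s) * (r + 2 * c + s) = c ^ 2 - r * s) ∧
    (-(2 : ℤ) * (3 * r + 5 * c + 2 * s) - 2 * (r + 2 * c + s) + (9 * r + 12 * c + 4 * s) = -2 * c - 2 * s + r) ∧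
    ((r, c, s) = (10, 2, 0) → (9 * r + 12 * c + 4 * s, 3 * r + 5 * c + 2 * s, r + 2 * c + s) = (114, 40, 14)) ∧
    ((r, c, s) = (114, 40, 14) → (9 * r + 12 * c + 4 * s, 3 * r + 5 * c + 2 * s, r + 2 * c + s) = (1562, 570, 208)) ∧
    (0 < c → c < r → 0 ≤ s → 10 ≤ r →
      0 < 3 * r + 5 * c + 2 * s ∧ 3 * r + 5 * c + 2 * s < 9 * r + 12 * c + 4 * s ∧ r + 2 ≤ r + 2 * c + s ∧ 12 ≤ r + 2 * c + s ∧
      10 ≤ 9 * r + 12 * c + 4 * s ∧ 3 ≤ (9 * r + 12 * c + 4 * s) - 6) := by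
  refine ⟨by ring, by ring, ?_, ?_, ?_⟩
  · rintro ⟨⟩; rfl
  · rintro ⟨⟩; rfl
  · intro hc hcr hs hr
    refine ⟨by omega, by omega, by omega, by omega, by omega, by omega⟩

/-- **THEOREM K2-∞, the direction orbit (report §13.2).** `g = [[1,1],[2,3]]` and `g⁻¹ = [[3,−1],[−2,1]]` are automorphs of
`q(a,b) = −2a² − 2ab + b²` (the rank form of the rigid class); on the positive branch `a, b > 0, b > a` is preserved (so `rk Q₂ = −q_{A₂} =
2a(a+2b) > 0` and `q_{B₁} = 2(a² − b²) < 0` keep the bi-positive sign pattern), on the negative branch from `(3,−2)` on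
`a > 0, b < 0, a + 2b < 0` is preserved (so `q_{A₂} = −2a(a+2b) > 0 > −2 = q_{A₁}`: NOT bi-positive). [shadow: the two inductions' steps] -/
theorem pg6_rank2_orbit_signs (a b : ℤ) :
    (-2 * (a + b) ^ 2 - 2 * (a + b) * (2 * a + 3 * b) + (2 * a + 3 * b) ^ 2 = -2 * a ^ 2 - 2 * a * b + b ^ 2) ∧
    (-2 * (3 * a - b) ^ 2 - 2 * (3 * a - b) * (-2 * a + b) + (-2 * a + b) ^ 2 = -2 * a ^ 2 - 2 * a * b + b ^ 2) ∧
    (0 < a → 0 < b → a < b → 0 < a + b ∧ 0 < 2 * a + 3 * b ∧ a + b < 2 * a + 3 * b) ∧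
    (0 < a → b < 0 → a + 2 * b < 0 → 0 < 3 * a - b ∧ -2 * a + b < 0 ∧ (3 * a - b) + 2 * (-2 * a + b) < 0) := by
  refine ⟨by ring, by ring, ?_, ?_⟩
  · intro ha hb hab; refine ⟨by omega, by omega, by omega⟩
  · intro ha hb hab; refine ⟨by omega, by omega, by omega⟩

/-- **The rank-two Pell branch is unique (report §13.2).** `x² − 3a² = 2` has no integer solution (squares are `0, 1 mod 3`), so every
rank-two direction solves `(b−a)² − 3a² = −2`. [shadow: residues] -/
theorem pg6_pell_minus_two_only (x a : ℤ) : x ^ 2 - 3 * a ^ 2 ≠ 2 := by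
  intro h
  have : x ^ 2 % 3 = 2 := by omega
  have hx : x % 3 = 0 ∨ x % 3 = 1 ∨ x % 3 = 2 := by omega
  rcases hx with hx | hx | hx <;>
    simp [pow_two, Int.mul_emod, hx] at this

end ProductGroundSix

end Summit.HodgeConjecture.HodgeConjecture.WeilTypeLadder
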